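import Summits.CriticalPhenomena.PercolationContinuityZ3.Theorems.PercNearOneGluingNoHeavyQuantGluedWindowLightOnly
import Summits.CriticalPhenomena.PercolationContinuityZ3.Theorems.PercNearOneGluingNoHeavyQuantGluedWindowLightIncPoly
import HarnessLib

/-!
# QUANT lane R8, T-DEC: LEMMA W's pair condition — the LIGHT / TOP-UNREACHABLE cell of the two-row regime (h a mid, both rows light into h, the bottom
# copy of `l` incompatible with the top copy: `2l + r + k ≤ T`, NO hypothesis on the middle copy) PROVED WITHOUT THE CONJECTURE; supersedes the light-only
# cell (`2l + 2r + k ≤ T`) of arm-1 g60 (arm-1 gen 61, architect)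

builds on p205010 (kernel theorem, internal audit signed; external expert review pending)

Support file (`--supports stmt-CriticalPhenomena-4575`), QUANT lane seat prim-quant-arm-1 (gen 61, architect); memo
`run/shared/lean/prim/quant/prim-quant-arm-1-g61/ARCH-G61.md` §1–§2.  Theorems only; standard axioms, no sorries, no definitions.

THE CELL.  Band frame and price system of `gluedPullback_windowPair_of_lemmaW`; light window pair `(l, h)` below a cheap atom `c ≥ h`; the two-row regime with
`h` a mid (`2(l+r) < T ≤ 2(l+r+k)`, `l+r+k ≤ j`, `T ≤ 2h`); the cell: the pair `(l, h)` is still LIGHT at the glued target (`T − 2l ≤ y(h − l)`, hence so is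
`(l+r, h)`) and the bottom copy of `l` cannot use the top copy `A = l+r+k` (`2l + r + k ≤ T`).  The middle copy MAY be compatible with `A` (flag patterns
`-lld ∣ llld`, `-lld ∣ Hlld` of the census kit j301043 besides g60's `-lld ∣ -lld`): the certificate simply does not use `A` — every copy of `h` (the mids `h`,
`h+r` and the discounted pool) absorbs row `i ∈ {l, l+r}` at the exact light power `ϖ_i = (1−G_i)/G_i` of `(i, h)`, shares `(σ, 1−σ)`, and the coverage
inequalities reduce (arm-1 g60's `lightOnly_main_of_star5`) to (★5) `t₀/Z₀ + t₁/Z₁ + t₂(1−y) ≤ 1/Z(ρ₀)`; with only `r + k ≤ T − 2l` the bound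
`A/d ≤ m/d ≤ t₁ε + t₂(1+y−c)` (`c = Z₀`, `ε = r/d`) turns it into (★7′) `t₀/c + t₁(1−ε)/(c+(1−y)ε) + t₂(1−y) ≤ 1/(c + t₁ε + t₂(1+y−c))` on the box
`y ≤ t₂`, `1 ≤ c ≤ 1+y`, `0 ≤ 2ε ≤ 1+y−c`, whose cleared form `lightInc_poly` (`…QuantGluedWindowLightIncPoly`) is replayed from an exact 177-term
Handelman certificate (kit j305169).  **`gluedPullback_windowPair_twoRow_lightInc`** — the hypothesis `2l + r + k ≤ T` is exactly "row `l` incompatible with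
`A`"; so after this file the open h-mid configurations with both rows light into `h` are those with `T < 2l + r + k` (row `l` HEAVY into `A`: it is never
light into `A` in the band, since `y(r+k) ≤ a·m ≤ T − 2l`), treated in `…QuantGluedWindowHeavyTop*`.

HONEST STATUS.  `GluedLemmaW` (flow form), `GluedDominatedMass`, the band, `SiblingStep`, `FarTreeRow` OPEN; RATE class (log\*) / honest sentence of
`run/shared/lean/prim/quant/README.md` unchanged.  [this work].  Nothing here is cited as a published result.  The gluing rows served
[cite: KozmaNitzan2024, Conjecture 3 (p. 15)]; product measure [cite: Grimmett1999, §1.3 p. 10].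
-/

set_option maxHeartbeats 4000000

noncomputable section

open scoped BigOperators

namespace Summit.CriticalPhenomena.PercolationContinuityZ3.Theorems
namespace Quant

open Finset

namespace LawDec

/-- (★7′) in division form: on the box `0 < y ≤ t₂ ≤ 1`, `t₁ ≥ 0`, `t₁ + t₂ ≤ 1`, `1 ≤ c ≤ 1 + y`, `0 ≤ 2ε ≤ 1 + y − c`:
`t₀/c + t₁(1−ε)/(c + (1−y)ε) + t₂(1−y) ≤ 1/(c + t₁ε + t₂(1+y−c))`, `t₀ = 1 − t₁ − t₂`. [this work] -/
theorem lightInc_star (y c e t1 t2 : ℝ) (hy0 : 0 < y) (hyt2 : y ≤ t2) (ht1 : 0 ≤ t1) (ht0 : 0 ≤ 1 - t1 - t2) (hc1 : 1 ≤ c)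
    (hcy : c ≤ 1 + y) (he0 : 0 ≤ e) (he1 : 2 * e ≤ 1 + y - c) (hy1 : y < 1) :
    (1 - t1 - t2) / c + t1 * (1 - e) / (c + (1 - y) * e) + t2 * (1 - y) ≤ 1 / (c + t1 * e + t2 * (1 + y - c)) := by
  have hP := lightInc_poly y t1 t2 c e hy0.le (by linarith) ht1 ht0 (by linarith) (by linarith) he0 (by linarith) (by linarith) (by linarith)
  have hc0 : 0 < c := by linarith
  have h1y : 0 ≤ 1 - y := by linarith
  have hce : 0 < c + (1 - y) * e := by have := mul_nonneg h1y he0; linarith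
  have ht2 : 0 ≤ t2 := by linarith
  have hD : 0 < c + t1 * e + t2 * (1 + y - c) := by
    have a1 : 0 ≤ t1 * e := mul_nonneg ht1 he0
    have a3 : 0 ≤ t2 * (1 + y - c) := mul_nonneg ht2 (by linarith)
    linarith [a1, a3]
  rw [le_div_iff₀ hD]
  obtain ⟨U, hU⟩ : ∃ U : ℝ, U = (1 - t1 - t2) / c := ⟨_, rfl⟩
  obtain ⟨V, hV⟩ : ∃ V : ℝ, V = t1 * (1 - e) / (c + (1 - y) * e) := ⟨_, rfl⟩
  have hUc : U * c = 1 - t1 - t2 := by rw [hU]; exact div_mul_cancel₀ _ hc0.ne'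
  have hVc : V * (c + (1 - y) * e) = t1 * (1 - e) := by rw [hV]; exact div_mul_cancel₀ _ hce.ne'
  rw [← hU, ← hV]
  rw [← hUc, ← hVc] at hP
  have e : c * (c + (1 - y) * e) - (c + t1 * e + t2 * (1 + y - c)) *
      (U * c * (c + (1 - y) * e) + V * (c + (1 - y) * e) * c + (1 - y) * t2 * c * (c + (1 - y) * e))
      = (c * (c + (1 - y) * e)) * (1 - (U + V + t2 * (1 - y)) * (c + t1 * e + t2 * (1 + y - c))) := by ring
  rw [e] at hP
  have := (mul_nonneg_iff_of_pos_left (mul_pos hc0 hce)).mp hP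
  linarith

/-- **THE LIGHT / TOP-UNREACHABLE CELL OF THE TWO-ROW REGIME (h a mid)**: `2l + r + k ≤ T` (the bottom copy cannot use the top copy; nothing is assumed
about the middle copy) and `T − 2l ≤ y(h − l)` (the pair is light at the glued target) ⟹ `(1−γ)Ψ(l) + γΨ(h) ≤ 0` for every price system and every cheap
`c ≥ h` — no `GluedLemmaW`.  Supersedes `gluedPullback_windowPair_twoRow_lightOnly` (which assumed `2l + 2r + k ≤ T`). [this work] -/
theorem gluedPullback_windowPair_twoRow_lightInc (x a q g S : ℝ) (B r k j l h c ls : ℕ) (α p : ℕ → ℝ)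
    (hx0 : 0 < x) (hx1 : x < 1) (ha0 : 0 < a) (ha1 : a ≤ 1) (hq0 : 0 < q) (hq1 : q < 1) (hg0 : 0 ≤ g) (hg1 : g ≤ 1) (hr : 1 ≤ r) (hk : 1 ≤ k)
    (hxqg : x ≤ q * g)
    (hlh : l < h) (hhB : h ≤ B) (hhj : h ≤ j) (hwin : j < h + r + k) (hlow : 2 * (l : ℝ) < a * S) (hcomp : a * S < (l : ℝ) + h)
    (hlight : pairGate (a * x) (a * S) l h < a * x)
    (hL2j : l + r + k ≤ j) (hL2mid : a * (S + q * ((r : ℝ) + k * g)) ≤ 2 * ((l : ℝ) + r + k))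
    (hL1low : 2 * ((l : ℝ) + r) < a * (S + q * ((r : ℝ) + k * g))) (hhmid : a * (S + q * ((r : ℝ) + k * g)) ≤ 2 * (h : ℝ))
    (hinc : 2 * (l : ℝ) + r + k ≤ a * (S + q * ((r : ℝ) + k * g)))
    (hlightT : a * (S + q * ((r : ℝ) + k * g)) - 2 * (l : ℝ) ≤ (a * x) * ((h : ℝ) - l))
    (hhc : h ≤ c) (hcB : c ≤ B) (hcj : c ≤ j)
    (hp : ∀ h, 0 ≤ p h)
    (hαp : ∀ l' h', l' ≤ j → 2 * (l' : ℝ) < a * (S + q * ((r : ℝ) + k * g)) → h' ≤ B + (r + k) →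
      (j + 1 ≤ h' ∨ a * (S + q * ((r : ℝ) + k * g)) < (l' : ℝ) + h') →
      α l' ≤ usage (a * x) (a * (S + q * ((r : ℝ) + k * g))) j l' h' * p h')
    (hcheap : -(gluedPullback (a * (S + q * ((r : ℝ) + k * g))) q g j r k α p c) * (a * x)
      < (1 - a * x) * gluedPullback (a * (S + q * ((r : ℝ) + k * g))) q g j r k α p ls) :
    (1 - pairGate (a * x) (a * S) l h) * gluedPullback (a * (S + q * ((r : ℝ) + k * g))) q g j r k α p l
      + pairGate (a * x) (a * S) l h * gluedPullback (a * (S + q * ((r : ℝ) + k * g))) q g j r k α p h ≤ 0 := by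
  -- names (no `set`: the reduction theorem is applied to the original expressions at the end)
  obtain ⟨y, hy⟩ : ∃ y : ℝ, y = a * x := ⟨_, rfl⟩
  obtain ⟨T, hT⟩ : ∃ T : ℝ, T = a * (S + q * ((r : ℝ) + k * g)) := ⟨_, rfl⟩
  obtain ⟨T₀, hT₀⟩ : ∃ T₀ : ℝ, T₀ = a * S := ⟨_, rfl⟩
  have hy0 : 0 < y := by rw [hy]; exact mul_pos ha0 hx0
  have hyx : y ≤ x := by rw [hy]; nlinarith
  have hy1 : y < 1 := by linarith
  have h1y : 0 < 1 - y := by linarith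
  obtain ⟨t1, ht1⟩ : ∃ t1 : ℝ, t1 = q * (1 - g) := ⟨_, rfl⟩
  obtain ⟨t2, ht2⟩ : ∃ t2 : ℝ, t2 = q * g := ⟨_, rfl⟩
  have ht1p : 0 ≤ t1 := by rw [ht1]; exact mul_nonneg hq0.le (by linarith)
  have ht2p : 0 ≤ t2 := by rw [ht2]; exact mul_nonneg hq0.le hg0
  have ht0p : 0 ≤ 1 - t1 - t2 := by
    rw [ht1, ht2, show 1 - q * (1 - g) - q * g = 1 - q by ring]; linarith
  have hyt2 : y ≤ t2 := by rw [ht2]; linarith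
  have hr1 : (1:ℝ) ≤ r := by exact_mod_cast hr
  have hk1 : (1:ℝ) ≤ k := by exact_mod_cast hk
  have hlh' : (l : ℝ) < h := by exact_mod_cast hlh
  -- geometry: d = h − l, N = T − 2l, A = T − T₀ ≤ m = t1 r + t2 (r+k)
  obtain ⟨d, hd⟩ : ∃ d : ℝ, d = (h : ℝ) - l := ⟨_, rfl⟩
  have hd0 : 0 < d := by rw [hd]; linarith
  obtain ⟨N, hN⟩ : ∃ N : ℝ, N = T - 2 * (l : ℝ) := ⟨_, rfl⟩
  have hA : T - T₀ = a * (q * ((r : ℝ) + k * g)) := by rw [hT, hT₀]; ring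
  have hAm : T - T₀ ≤ t1 * r + t2 * ((r : ℝ) + k) := by
    rw [hA, ht1, ht2]
    have h1 : a * (q * ((r : ℝ) + k * g)) ≤ 1 * (q * ((r : ℝ) + k * g)) :=
      mul_le_mul_of_nonneg_right ha1 (by positivity)
    have e : q * (1 - g) * (r : ℝ) + q * g * ((r : ℝ) + k) = 1 * (q * ((r : ℝ) + k * g)) := by ring
    linarith [h1, e]
  have hA0 : 0 ≤ T - T₀ := by rw [hA]; positivity
  have hNK : (r : ℝ) + k ≤ N := by rw [hN, hT]; linarith        -- 2l + r + k ≤ T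
  have hNy : N ≤ y * d := by rw [hN, hd, hT, hy]; exact hlightT      -- light at T
  have hNd : N < d := lt_of_le_of_lt hNy ((mul_lt_iff_lt_one_left hd0).mpr hy1)
  -- the light gate of the first factor
  obtain ⟨ρ₀, hρ₀⟩ : ∃ ρ₀ : ℝ, ρ₀ = (T₀ - 2 * (l : ℝ)) / ((h : ℝ) - l) := ⟨_, rfl⟩
  have hρ₀y : ρ₀ < y := by
    have : (T₀ - 2 * (l : ℝ)) / ((h : ℝ) - l) ≤ pairGate y T₀ l h := le_max_left _ _
    rw [hρ₀]; rw [hy, hT₀] at this ⊢; linarith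
  obtain ⟨γ, hγ⟩ : ∃ γ : ℝ, γ = y ^ 2 + (1 - y) * ρ₀ := ⟨_, rfl⟩
  have hγ' : pairGate (a * x) (a * S) l h = γ := by
    rw [hγ, hρ₀, hT₀, hy]; exact pairGate_eq_light (a * x) (a * S) l h (mul_pos ha0 hx0).le (by rw [← hy, ← hT₀, ← hρ₀]; exact hρ₀y.le)
  have eρ₀ : ρ₀ = (N - (T - T₀)) / d := by rw [hρ₀, hN, hd]; congr 1; ring
  have hρ₀0 : 0 < ρ₀ := by rw [hρ₀]; exact div_pos (by rw [hT₀]; linarith) (by linarith)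
  -- credit ratios of the two rows into h at T
  obtain ⟨ρa, hρa⟩ : ∃ ρa : ℝ, ρa = N / d := ⟨_, rfl⟩
  obtain ⟨ρb, hρb⟩ : ∃ ρb : ℝ, ρb = (N - 2 * (r : ℝ)) / (d - r) := ⟨_, rfl⟩
  have hdr : 0 < d - r := by linarith
  have hρay : ρa ≤ y := by rw [hρa, div_le_iff₀ hd0]; linarith
  have hρa0 : 0 < ρa := by rw [hρa]; exact div_pos (by linarith) hd0
  have hρb0 : 0 < ρb := by rw [hρb]; exact div_pos (by rw [hN, hT]; linarith) hdr
  have hN2d : N ≤ 2 * d := by rw [hN, hd, hT]; linarith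
  have hr0 : (0:ℝ) ≤ r := by linarith
  have hρba : ρb ≤ ρa := by
    rw [hρa, hρb, div_le_div_iff₀ hdr hd0]; linarith [mul_le_mul_of_nonneg_left hN2d hr0]
  have hρby : ρb ≤ y := le_trans hρba hρay
  -- exact light powers
  obtain ⟨Ga, hGa⟩ : ∃ Ga : ℝ, Ga = y ^ 2 + (1 - y) * ρa := ⟨_, rfl⟩
  obtain ⟨Gb, hGb⟩ : ∃ Gb : ℝ, Gb = y ^ 2 + (1 - y) * ρb := ⟨_, rfl⟩
  have hGa0 : 0 < Ga := by rw [hGa]; exact add_pos_of_pos_of_nonneg (pow_pos hy0 2) (mul_nonneg h1y.le hρa0.le)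
  have hGb0 : 0 < Gb := by rw [hGb]; exact add_pos_of_pos_of_nonneg (pow_pos hy0 2) (mul_nonneg h1y.le hρb0.le)
  have hGa1 : 0 < 1 - Ga := by
    rw [hGa, show 1 - (y ^ 2 + (1 - y) * ρa) = (1 - y) * (1 + y - ρa) by ring]; exact mul_pos h1y (by linarith)
  have hGb1 : 0 < 1 - Gb := by
    rw [hGb, show 1 - (y ^ 2 + (1 - y) * ρb) = (1 - y) * (1 + y - ρb) by ring]; exact mul_pos h1y (by linarith)
  obtain ⟨ϖa, hϖa⟩ : ∃ ϖa : ℝ, ϖa = (1 - Ga) / Ga := ⟨_, rfl⟩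
  obtain ⟨ϖb, hϖb⟩ : ∃ ϖb : ℝ, ϖb = (1 - Gb) / Gb := ⟨_, rfl⟩
  have hϖa0 : 0 < ϖa := by rw [hϖa]; exact div_pos hGa1 hGa0
  have hϖb0 : 0 < ϖb := by rw [hϖb]; exact div_pos hGb1 hGb0
  -- validity into h (exact light rate), into h + r (nearer-to-farther), and compatibility
  have hcompa : T < (l : ℝ) + h := by rw [hN, hd] at hNd; linarith
  have hcompb : T < ((l : ℝ) + r) + h := by
    have : N - (r : ℝ) < d := by linarith
    rw [hN, hd] at this; linarith
  have eLr : ((l + r : ℕ) : ℝ) = (l : ℝ) + r := by push_cast; ring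
  have vaH : ϖa * usage y T j l h ≤ 1 := by
    have hρ : (T - 2 * (l : ℝ)) / ((h : ℝ) - l) ≤ y := by rw [← hN, ← hd, ← hρa]; exact hρay
    rw [usage_light_eq y T j l h hy0.le hhj hρ, ← hN, ← hd, ← hρa, ← hGa, hϖa, div_mul_div_comm, mul_comm (1 - Ga) Ga,
      div_self (mul_ne_zero hGa0.ne' hGa1.ne')]
  have vbH : ϖb * usage y T j (l + r) h ≤ 1 := by
    have e1 : (T - 2 * ((l + r : ℕ) : ℝ)) / ((h : ℝ) - ((l + r : ℕ) : ℝ)) = ρb := by rw [hρb, hN, hd, eLr]; ring_nf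
    have hρ : (T - 2 * ((l + r : ℕ) : ℝ)) / ((h : ℝ) - ((l + r : ℕ) : ℝ)) ≤ y := by rw [e1]; exact hρby
    rw [usage_light_eq y T j (l + r) h hy0.le hhj hρ, e1, ← hGb, hϖb, div_mul_div_comm, mul_comm (1 - Gb) Gb,
      div_self (mul_ne_zero hGb0.ne' hGb1.ne')]
  have hlowl : 2 * (l : ℝ) < T := by linarith
  have hlowlr : 2 * ((l + r : ℕ) : ℝ) < T := by rw [eLr]; linarith
  have vaG : ϖa * usage y T j l (h + r) ≤ 1 ∨ j < h + r := by
    by_cases hjr : h + r ≤ j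
    · exact Or.inl (le_trans (mul_le_mul_of_nonneg_left (usage_anti_mid y T j l h (h + r) hy0 hy1 (by omega) hjr hlowl hcompa) hϖa0.le) vaH)
    · exact Or.inr (by omega)
  have vbG : ϖb * usage y T j (l + r) (h + r) ≤ 1 ∨ j < h + r := by
    by_cases hjr : h + r ≤ j
    · refine Or.inl (le_trans (mul_le_mul_of_nonneg_left (usage_anti_mid y T j (l + r) h (h + r) hy0 hy1 (by omega) hjr hlowlr ?_) hϖb0.le) vbH)
      rw [eLr]; exact hcompb
    · exact Or.inr (by omega)
  -- the main inequality (1−γ)(t0/ϖa + t1/ϖb) ≤ γ via (★7)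
  obtain ⟨cc, hcc⟩ : ∃ cc : ℝ, cc = 1 + y - ρa := ⟨_, rfl⟩
  obtain ⟨ee, hee⟩ : ∃ ee : ℝ, ee = (r : ℝ) / d := ⟨_, rfl⟩
  obtain ⟨aa, haa⟩ : ∃ aa : ℝ, aa = (T - T₀) / d := ⟨_, rfl⟩
  have hcc1 : 1 ≤ cc := by rw [hcc]; linarith
  have hccy : cc ≤ 1 + y := by rw [hcc]; linarith
  have hee0 : 0 ≤ ee := by rw [hee]; positivity
  have haa0 : 0 ≤ aa := by rw [haa]; positivity
  have hee1 : 2 * ee ≤ 1 + y - cc := by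
    rw [hee, hcc, hρa]
    have : 2 * ((r : ℝ) / d) = (2 * r) / d := by ring
    rw [this, show 1 + y - (1 + y - N / d) = N / d by ring, div_le_div_iff₀ hd0 hd0]
    exact mul_le_mul_of_nonneg_right (by linarith) hd0.le
  have haamax : aa ≤ t1 * ee + t2 * (1 + y - cc) := by
    rw [haa, hee, hcc, hρa, show 1 + y - (1 + y - N / d) = N / d by ring,
      show t1 * ((r : ℝ) / d) + t2 * (N / d) = (t1 * r + t2 * N) / d by ring, div_le_div_iff₀ hd0 hd0]
    have : t1 * (r : ℝ) + t2 * ((r : ℝ) + k) ≤ t1 * r + t2 * N := by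
      linarith [mul_le_mul_of_nonneg_left hNK ht2p]
    exact mul_le_mul_of_nonneg_right (by linarith) hd0.le
  have star7 := lightInc_star y cc ee t1 t2 hy0 hyt2 ht1p ht0p hcc1 hccy hee0 hee1 hy1
  have hden : 0 < cc + t1 * ee + t2 * (1 + y - cc) := by
    have a1 : 0 ≤ t1 * ee := mul_nonneg ht1p hee0
    have a3 : 0 ≤ t2 * (1 + y - cc) := mul_nonneg ht2p (by linarith)
    linarith [a1, a3]
  have star6 : (1 - t1 - t2) / cc + t1 * (1 - ee) / (cc + (1 - y) * ee) + t2 * (1 - y) ≤ 1 / (cc + aa) := by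
    refine le_trans star7 ?_
    rw [one_div_le_one_div hden (by linarith)]
    linarith
  -- (★5): Za = cc, 1/Zb = (1−ee)/(cc+(1−y)ee), Z = cc + aa
  obtain ⟨Zb, hZb⟩ : ∃ Zb : ℝ, Zb = 1 + y - ρb := ⟨_, rfl⟩
  have hZb0 : 0 < Zb := by rw [hZb]; linarith
  have hcce : 0 < cc + (1 - y) * ee := by have := mul_nonneg h1y.le hee0; linarith
  have eZb : 1 / Zb = (1 - ee) / (cc + (1 - y) * ee) := by
    rw [div_eq_div_iff hZb0.ne' hcce.ne', one_mul, hZb, hcc, hee, hρb, hρa]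
    field_simp
    ring
  have eZ : 1 + y - ρ₀ = cc + aa := by rw [hcc, haa, eρ₀, hρa, sub_div]; ring
  have star5 : (1 - t1 - t2) / cc + t1 / Zb + t2 * (1 - y) ≤ 1 / (1 + y - ρ₀) := by
    rw [eZ, div_eq_mul_one_div t1 Zb, eZb, ← mul_div_assoc]
    exact star6
  have main' := lightOnly_main_of_star5 y (1 + y - ρ₀) cc Zb (1 - t1 - t2) t1 t2 hy1 (by linarith) (by linarith) hZb0 (by ring) star5
  have eϖa : (1 - y) * cc / (1 - (1 - y) * cc) = ϖa := by
    rw [hϖa, hGa, hcc]; congr 1 <;> ring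
  have eϖb : (1 - y) * Zb / (1 - (1 - y) * Zb) = ϖb := by
    rw [hϖb, hGb, hZb]; congr 1 <;> ring
  have e1γ : (1 - y) * (1 + y - ρ₀) = 1 - γ := by rw [hγ]; ring
  rw [eϖa, eϖb, e1γ, show 1 - (1 - γ) = γ by ring] at main'
  -- main' : (1 − γ) * ((1 − t1 − t2)/ϖa + t1/ϖb) ≤ γ
  have hγ0 : 0 < γ := by rw [hγ]; exact add_pos_of_pos_of_nonneg (pow_pos hy0 2) (mul_pos h1y hρ₀0).le
  have h1γ : 0 < 1 - γ := by
    rw [hγ, show 1 - (y ^ 2 + (1 - y) * ρ₀) = (1 - y) * (1 + y - ρ₀) by ring]; exact mul_pos h1y (by linarith)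
  -- the share σ = w₀/D₀ and the two coverages
  obtain ⟨σ, hσ⟩ : ∃ σ : ℝ, σ = (1 - γ) * (1 - t1 - t2) / (γ * ϖa) := ⟨_, rfl⟩
  have hγϖa : 0 < γ * ϖa := mul_pos hγ0 hϖa0
  have hσγ : σ * (γ * ϖa) = (1 - γ) * (1 - t1 - t2) := by rw [hσ]; exact div_mul_cancel₀ _ hγϖa.ne'
  have hσ0 : 0 ≤ σ := by rw [hσ]; exact div_nonneg (mul_nonneg h1γ.le ht0p) hγϖa.le
  have m2 : (1 - γ) * (1 - t1 - t2) * ϖb + (1 - γ) * t1 * ϖa ≤ γ * ϖa * ϖb := by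
    have := mul_le_mul_of_nonneg_right main' (mul_nonneg hϖa0.le hϖb0.le)
    have ca : (1 - t1 - t2) / ϖa * ϖa = 1 - t1 - t2 := div_mul_cancel₀ _ hϖa0.ne'
    have cb : t1 / ϖb * ϖb = t1 := div_mul_cancel₀ _ hϖb0.ne'
    have e : (1 - γ) * ((1 - t1 - t2) / ϖa + t1 / ϖb) * (ϖa * ϖb) = (1 - γ) * (1 - t1 - t2) * ϖb + (1 - γ) * t1 * ϖa := by
      linear_combination ((1 - γ) * ϖb) * ca + ((1 - γ) * ϖa) * cb
    rw [e] at this; linarith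
  have hσ1 : σ ≤ 1 := by
    rw [hσ, div_le_one hγϖa]
    have h3 : (1 - γ) * (1 - t1 - t2) * ϖb ≤ γ * ϖa * ϖb := by
      linarith [m2, mul_nonneg (mul_nonneg h1γ.le ht1p) hϖa0.le]
    exact le_of_mul_le_mul_right h3 hϖb0
  have cov1' : (1 - γ) * t1 ≤ (1 - σ) * (γ * ϖb) := by
    -- (1 − σ)γϖb·ϖa = γϖaϖb − (1−γ)t0ϖb ≥ (1−γ)t1ϖa
    have e : (1 - σ) * (γ * ϖb) * ϖa = γ * ϖa * ϖb - σ * (γ * ϖa) * ϖb := by ring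
    have h2 : (1 - γ) * t1 * ϖa ≤ (1 - σ) * (γ * ϖb) * ϖa := by rw [e, hσγ]; linarith
    exact le_of_mul_le_mul_right h2 hϖa0
  have et0 : 1 - t1 - t2 = 1 - q := by rw [ht1, ht2]; ring
  -- apply the reduction theorem
  by_cases hjr : h + r ≤ j
  · have vaG' : ϖa * usage y T j l (h + r) ≤ 1 := by rcases vaG with h1 | h1; exacts [h1, absurd hjr (by omega)]
    have vbG' : ϖb * usage y T j (l + r) (h + r) ≤ 1 := by rcases vbG with h1 | h1; exacts [h1, absurd hjr (by omega)]
    refine gluedPullback_windowPair_twoRow_mid_of_share x a q g S B r k j l h c ls α p 0 σ 0 ϖa ϖa ϖa 0 ϖb ϖb ϖb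
      hx0 hx1 ha0 ha1 hq0 hq1 hg0 hg1 hr hlh hhB hwin hlow hcomp hL2j hL2mid hL1low hhmid (Or.inl ⟨hjr, rfl⟩) hhc hcB hcj hp hαp hcheap
      hσ0 hσ1 le_rfl hϖa0.le hϖa0.le hϖa0.le le_rfl hϖb0.le hϖb0.le hϖb0.le ?_ (Or.inl rfl) ?_ (Or.inr ?_) ?_ (Or.inr (Or.inr ?_)) (Or.inr ⟨?_, ?_⟩)
      ?_ (Or.inl rfl) ?_ (Or.inr ?_) ?_ (Or.inr (Or.inr ?_)) (Or.inr ⟨?_, ?_⟩) ?_ ?_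
    · rw [zero_mul]; exact zero_le_one
    · rw [← hy, ← hT]; exact vaH
    · rw [← hT]; exact hcompa
    · rw [← hy, ← hT]; exact vaG'
    · rw [← hT]; linarith
    · rw [← hT]; exact hcompa
    · rw [← hy, ← hT]; exact vaH
    · rw [zero_mul]; exact zero_le_one
    · rw [← hy, ← hT]; exact vbH
    · rw [← hT]; exact hcompb
    · rw [← hy, ← hT]; exact vbG'
    · rw [← hT]; linarith
    · rw [← hT]; exact hcompb
    · rw [← hy, ← hT]; exact vbH
    · rw [hγ', ← ht1, ← ht2, ← et0]
      have e : σ * ((1 - γ) * t2 * 0 + γ * (1 - t1 - t2) * ϖa + γ * t1 * (1 - 0) * ϖa + γ * (t2 + 0 * t1) * ϖa) = σ * (γ * ϖa) := by ring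
      rw [e, hσγ]
    · rw [hγ', ← ht1, ← ht2]
      have e : (1 - σ) * ((1 - γ) * t2 * 0 + γ * (1 - q) * ϖb + γ * t1 * (1 - 0) * ϖb + γ * (t2 + 0 * t1) * ϖb)
          = (1 - σ) * (γ * ϖb) * ((1 - q) + t1 + t2) := by ring
      rw [e, ← et0, show 1 - t1 - t2 + t1 + t2 = (1:ℝ) by ring, mul_one]
      exact cov1'
  · have hjr' : j < h + r := by omega
    refine gluedPullback_windowPair_twoRow_mid_of_share x a q g S B r k j l h c ls α p 1 σ 0 ϖa 0 ϖa 0 ϖb 0 ϖb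
      hx0 hx1 ha0 ha1 hq0 hq1 hg0 hg1 hr hlh hhB hwin hlow hcomp hL2j hL2mid hL1low hhmid (Or.inr ⟨hjr', rfl⟩) hhc hcB hcj hp hαp hcheap
      hσ0 hσ1 le_rfl hϖa0.le le_rfl hϖa0.le le_rfl hϖb0.le le_rfl hϖb0.le ?_ (Or.inl rfl) ?_ (Or.inr ?_) ?_ (Or.inl rfl) (Or.inr ⟨?_, ?_⟩)
      ?_ (Or.inl rfl) ?_ (Or.inr ?_) ?_ (Or.inl rfl) (Or.inr ⟨?_, ?_⟩) ?_ ?_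
    · rw [zero_mul]; exact zero_le_one
    · rw [← hy, ← hT]; exact vaH
    · rw [← hT]; exact hcompa
    · rw [zero_mul]; exact zero_le_one
    · rw [← hT]; exact hcompa
    · rw [← hy, ← hT]; exact vaH
    · rw [zero_mul]; exact zero_le_one
    · rw [← hy, ← hT]; exact vbH
    · rw [← hT]; exact hcompb
    · rw [zero_mul]; exact zero_le_one
    · rw [← hT]; exact hcompb
    · rw [← hy, ← hT]; exact vbH
    · rw [hγ', ← ht1, ← ht2, ← et0]
      have e : σ * ((1 - γ) * t2 * 0 + γ * (1 - t1 - t2) * ϖa + γ * t1 * (1 - 1) * 0 + γ * (t2 + 1 * t1) * ϖa) = σ * (γ * ϖa) := by ring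
      rw [e, hσγ]
    · rw [hγ', ← ht1, ← ht2]
      have e : (1 - σ) * ((1 - γ) * t2 * 0 + γ * (1 - q) * ϖb + γ * t1 * (1 - 1) * 0 + γ * (t2 + 1 * t1) * ϖb)
          = (1 - σ) * (γ * ϖb) * ((1 - q) + t1 + t2) := by ring
      rw [e, ← et0, show 1 - t1 - t2 + t1 + t2 = (1:ℝ) by ring, mul_one]
      exact cov1'

end LawDec
end Quant
end Summit.CriticalPhenomena.PercolationContinuityZ3.Theorems
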